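import Literature.IUT.HodgeArakelov.ConstantMultipleRigidity

/-!
# [IUTchII] Cor 1.12 (iii): the diagram `(†μ,×μ)` exists from its printed inputs (proof-only)

Proof-only companion (abc-iut cell, D-0067 wave 4, seat abc-iut-w4-d041; node **IUTchII:Cor1.12(iii)**)
of `ConstantMultipleRigidity.lean` (abc-iut-L6-t1, v2). No definitions.

S. Mochizuki, *Inter-universal Teichmüller theory II*, kurims manuscript (Dec. 2020), Cor. 1.12 (iii),
p. 58: "the diagram `Π_μ(M^Θ_*(Π)) ⊗ ℚ/ℤ ≅ M^μ_TM(M^Θ_*(Π)) ≅ M^μ_TM(Π) → M^{×μ}_TM(Π) ≅ O^{×μ}(G)`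
`(†μ,×μ)` — where the first `≅` is the isomorphism determined by the injection of Remark 1.5.2; the
second `≅` is the isomorphism determined by the vertical arrows of `(†×θ)(Π)`; the `→` is the trivial
homomorphism; the final `≅` denotes the poly-isomorphism induced by the poly-isomorphism `α_×` of
Example 1.8, (iii)". Claim key `Mochizuki2012`, status DISPUTED (D-0012); what is proved here is
abelian-group algebra over the typed interface and takes no side.

WHAT IS PROVED. The typed diagram is the DATA `MuXmuDiagram Ev A G Q κ` (abc-iut-L6-t1). Here:
* `ThetaEvaluation.nonempty_muXmuDiagram`: the diagram EXISTS as soon as (`hκ`) `κ` is the injection of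
  Remark 1.5.2 with image the torsion — the named fact `Rmk152_kummerTorsion T Q κ`, taken BY NAME —,
  (`hμ`) every torsion element of the ambient direct limit `lim_J H¹(Π_Ÿ(Π)|_J, (l·Δ_Θ)(Π))` is (the image
  of) a unit class, i.e. lies in `M^×_TM(Π)` (so that "`M^μ_TM(-)` = the submodule of torsion elements",
  p. 56, is ALL the torsion, as the first `≅` requires), and (`P₄₅`, `h₄₅`) the last poly-isomorphism
  `M^{×μ}_TM(Π) ≅ O^{×μ}(G)` is GIVEN (it is induced by `α_×` of Ex. 1.8 (iii) through the Kummer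
  identification of [AbsTopIII] Prop. 3.2, which the cohomology interface does not carry — an honest
  input, exactly as in the typed structure). The first `≅` is then BUILT from `κ`, the second `≅` is BUILT
  from the vertical arrow `transportLim ∘ inclHd` of `(†×θ)(Π)` with no hypothesis at all, and the third
  arrow is the trivial homomorphism (`ThetaEvaluation.mmuTM_to_mxmuTM_eq_zero`, abc-iut-L6-t1).
* `MuXmuDiagram.e₂₃_unique`: the second `≅` is uniquely determined by its compatibility with the vertical
  arrow (complementing abc-iut-L6-t1's `MuXmuDiagram.e₁₂_unique` for the first `≅`), so the `Nonempty`
  statement loses no information on the first three arrows.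
* `ThetaEvaluation.torsion_mem_MxTMEnv_of_muXmuDiagram`: conversely, given the Remark 1.5.2 injection,
  ANY such diagram forces the input `hμ` (every torsion element is a unit class) — the input is exactly
  what the typed diagram carries, not an artefact.
The multiradiality clause of (iii) is abc-iut-L6-t1's cross-reference to the shape theorem
`cor111_multiradiallyDefined` (PROVED) and is not restated here.

HONEST FRAMING: nothing here asserts that abc is proved or refuted or takes a side on [IUTchIII] Cor. 3.12;
typed ≠ discharged; this file discharges the EXISTENCE of the typed diagram RELATIVE TO the named inputs.
-/

namespace Literature.IUT.HodgeArakelov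

universe u

variable {S : ThetaSetting.{u}} {F : ModelFamily S} {Sys : MonoThetaProjSystem F}
  {T : ThetaEnvData Sys} {E : EnvOfGroup S Sys.PiX} {I : PointedInversion E T.D}

/-- Finite order is detected inside an additive subgroup (the subgroup inclusion is injective).
[claim: Mochizuki2012, status: disputed] -/
private theorem isOfFinAddOrder_mk_iff {L : Type u} [AddCommGroup L] (M : AddSubgroup L) {x : L}
    (hx : x ∈ M) : IsOfFinAddOrder (⟨x, hx⟩ : M) ↔ IsOfFinAddOrder x :=
  ((AddSubgroup.subtype_injective M).isOfFinAddOrder_iff (f := M.subtype)).symm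

namespace ThetaEvaluation

variable (Ev : ThetaEvaluation T E I)

/-- Membership in `M^×_TM(M^Θ_*(Π))` (the transported unit classes, (d) of `(†×θ)(Π)`, kurims p. 56):
`y ∈ M^×_TM(M^Θ_*(Π))` iff `y` is the transport of the image of a unit class.
[claim: Mochizuki2012, status: disputed] -/
theorem mem_MxTMEnv_iff (y : T.cohEnv.lim) :
    y ∈ Ev.MxTMEnv ↔ ∃ m ∈ Ev.MxTM, T.transportLim (Ev.inclHd m) = y := by
  simp only [ThetaEvaluation.MxTMEnv, AddSubgroup.mem_map, AddEquiv.coe_toAddMonoidHom]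
  constructor
  · rintro ⟨z, ⟨m, hm, rfl⟩, rfl⟩
    exact ⟨m, hm, rfl⟩
  · rintro ⟨m, hm, rfl⟩
    exact ⟨Ev.inclHd m, ⟨m, hm, rfl⟩, rfl⟩

/-- The vertical arrow of `(†×θ)(Π)` restricted to the unit classes is injective:
`m ↦ transportLim (inclHd m)` (cyclotomic-rigidity transport after the natural inclusion (c), p. 56).
[claim: Mochizuki2012, status: disputed] -/
theorem transportLim_inclHd_injective :
    Function.Injective fun m : Ev.Hd => T.transportLim (Ev.inclHd m) :=
  T.transportLim.injective.comp Ev.inclHd_injective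

/-- **IUTchII:Cor1.12(iii)** (kurims p. 58), EXISTENCE of the diagram `(†μ,×μ)` from its printed inputs:
the Remark 1.5.2 injection `κ` (named fact `Rmk152_kummerTorsion`, BY NAME), "the torsion elements are
unit classes" (`hμ`), and the given last poly-isomorphism (`P₄₅`, induced by `α_×` of Ex. 1.8 (iii)).
[claim: Mochizuki2012, status: disputed] -/
theorem nonempty_muXmuDiagram (A : AbsTopMonoids S) (G : IsoClass S.Gk) {Q : Type u} [AddCommGroup Q]
    {κ : Q →+ T.cohEnv.lim} (hκ : Rmk152_kummerTorsion T Q κ)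
    (hμ : ∀ x : T.D.coh.lim, IsOfFinAddOrder x → x ∈ Ev.MxTM.map Ev.inclHd)
    (P₄₅ : Set (Multiplicative Ev.MxmuTM ≃* A.Oxmu G)) (h₄₅ : P₄₅.Nonempty) :
    Nonempty (MuXmuDiagram Ev A G Q κ) := by
  classical
  -- (0) the torsion of the mono-theta-side limit lies in `M^×_TM(M^Θ_*(Π))`
  have hμEnv : ∀ y : T.cohEnv.lim, IsOfFinAddOrder y → y ∈ Ev.MxTMEnv := by
    intro y hy
    have hy' : IsOfFinAddOrder (T.transportLim.symm y) := T.transportLim.symm.toAddMonoidHom.isOfFinAddOrder hy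
    obtain ⟨m, hm, hmy⟩ := AddSubgroup.mem_map.mp (hμ _ hy')
    rw [Ev.mem_MxTMEnv_iff]
    exact ⟨m, hm, by rw [hmy, AddEquiv.apply_symm_apply]⟩
  -- (1) the second `≅`: the vertical arrow restricted to the unit classes is a bijection onto
  --     `M^×_TM(M^Θ_*(Π))`, hence identifies the torsion subgroups
  have hmem : ∀ m : Ev.MxTM,
      ((T.transportLim.toAddMonoidHom.comp Ev.inclHd).comp Ev.MxTM.subtype) m ∈ Ev.MxTMEnv := by
    intro m
    rw [Ev.mem_MxTMEnv_iff]
    exact ⟨m, m.2, rfl⟩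
  let ψ : Ev.MxTM →+ Ev.MxTMEnv :=
    ((T.transportLim.toAddMonoidHom.comp Ev.inclHd).comp Ev.MxTM.subtype).codRestrict Ev.MxTMEnv hmem
  have hψ_apply : ∀ m : Ev.MxTM, ((ψ m : Ev.MxTMEnv) : T.cohEnv.lim) = T.transportLim (Ev.inclHd m) :=
    fun m => rfl
  have hψ_inj : Function.Injective ψ := by
    intro m m' h
    have h' := congrArg (fun z : Ev.MxTMEnv => (z : T.cohEnv.lim)) h
    simp only [hψ_apply] at h'
    exact Subtype.ext (Ev.transportLim_inclHd_injective h')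
  have hψ_surj : Function.Surjective ψ := by
    intro y
    obtain ⟨m, hm, hmy⟩ := (Ev.mem_MxTMEnv_iff (y : T.cohEnv.lim)).mp y.2
    exact ⟨⟨m, hm⟩, Subtype.ext (by rw [hψ_apply]; exact hmy)⟩
  let Φ : Ev.MxTM ≃+ Ev.MxTMEnv := AddEquiv.ofBijective ψ ⟨hψ_inj, hψ_surj⟩
  have hΦ_apply : ∀ m : Ev.MxTM, ((Φ m : Ev.MxTMEnv) : T.cohEnv.lim) = T.transportLim (Ev.inclHd m) :=
    fun m => rfl
  have htorsΦ : ∀ y : Ev.MxTMEnv, IsOfFinAddOrder y → IsOfFinAddOrder (Φ.symm y) :=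
    fun y hy => Φ.symm.toAddMonoidHom.isOfFinAddOrder hy
  have htorsΦ' : ∀ m : Ev.MxTM, IsOfFinAddOrder m → IsOfFinAddOrder (Φ m) :=
    fun m hm => Φ.toAddMonoidHom.isOfFinAddOrder hm
  let e₂₃ : Ev.MmuTMEnv ≃+ Ev.MmuTM :=
    { toFun := fun x => ⟨Φ.symm x.1, htorsΦ x.1 x.2⟩
      invFun := fun y => ⟨Φ y.1, htorsΦ' y.1 y.2⟩
      left_inv := fun x => Subtype.ext (Φ.apply_symm_apply x.1)
      right_inv := fun y => Subtype.ext (Φ.symm_apply_apply y.1)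
      map_add' := fun x y => Subtype.ext (map_add Φ.symm x.1 y.1) }
  have he₂₃ : ∀ x : Ev.MmuTMEnv,
      T.transportLim (Ev.inclHd (((e₂₃ x : Ev.MmuTM) : Ev.MxTM) : Ev.Hd)) = ((x : Ev.MxTMEnv) : T.cohEnv.lim) := by
    intro x
    have h := hΦ_apply (Φ.symm x.1)
    rw [AddEquiv.apply_symm_apply] at h
    exact h.symm
  -- (2) the first `≅`: from the Remark 1.5.2 injection `κ` (image = the torsion, all of it in `M^×_TM`)
  have hκtors : ∀ q : Q, IsOfFinAddOrder (κ q) := by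
    intro q
    have hq : κ q ∈ Set.range κ := ⟨q, rfl⟩
    rw [hκ.2] at hq
    exact hq
  have hκmem : ∀ q : Q, κ q ∈ Ev.MxTMEnv := fun q => hμEnv (κ q) (hκtors q)
  let κ₁ : Q →+ Ev.MxTMEnv := κ.codRestrict Ev.MxTMEnv hκmem
  have hκ₁tors : ∀ q : Q, κ₁ q ∈ Ev.MmuTMEnv := fun q =>
    (AddCommGroup.mem_torsion _).mpr ((isOfFinAddOrder_mk_iff Ev.MxTMEnv (hκmem q)).mpr (hκtors q))
  let κ₂ : Q →+ Ev.MmuTMEnv := κ₁.codRestrict Ev.MmuTMEnv hκ₁tors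
  have hκ₂_apply : ∀ q : Q, (((κ₂ q : Ev.MmuTMEnv) : Ev.MxTMEnv) : T.cohEnv.lim) = κ q := fun q => rfl
  have hκ₂_inj : Function.Injective κ₂ := by
    intro q q' h
    exact hκ.1 ((hκ₂_apply q).symm.trans ((congrArg (fun z : Ev.MmuTMEnv => ((z : Ev.MxTMEnv) : T.cohEnv.lim)) h).trans (hκ₂_apply q')))
  have hκ₂_surj : Function.Surjective κ₂ := by
    intro x
    have hx : IsOfFinAddOrder ((x : Ev.MxTMEnv) : T.cohEnv.lim) := by
      have h1 : IsOfFinAddOrder (x : Ev.MxTMEnv) := (AddCommGroup.mem_torsion _).mp x.2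
      exact Ev.MxTMEnv.subtype.isOfFinAddOrder h1
    have hx' : ((x : Ev.MxTMEnv) : T.cohEnv.lim) ∈ Set.range κ := by rw [hκ.2]; exact hx
    obtain ⟨q, hq⟩ := hx'
    exact ⟨q, Subtype.ext (Subtype.ext ((hκ₂_apply q).trans hq))⟩
  let e₁₂ : Q ≃+ Ev.MmuTMEnv := AddEquiv.ofBijective κ₂ ⟨hκ₂_inj, hκ₂_surj⟩
  have he₁₂ : ∀ q : Q, (((e₁₂ q : Ev.MmuTMEnv) : Ev.MxTMEnv) : T.cohEnv.lim) = κ q := fun q => rfl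
  -- (3) assemble
  exact ⟨{ e₁₂ := e₁₂, e₁₂_compat := he₁₂, e₂₃ := e₂₃, e₂₃_compat := he₂₃,
            poly₄₅ := P₄₅, poly₄₅_nonempty := h₄₅ }⟩

/-- CONVERSELY (kurims p. 58 with Rmk. 1.5.2, pp. 30–31): given the Remark 1.5.2 injection `κ` (image = ALL
torsion of the limit), any diagram `(†μ,×μ)` forces every torsion element of
`lim_J H¹(Π_Ÿ(M^Θ_*)|_J, Π_μ(M^Θ_*))` to lie in `M^×_TM(M^Θ_*(Π))` — the input `hμ` of
`nonempty_muXmuDiagram` is exactly what the typed diagram carries. [claim: Mochizuki2012, status: disputed] -/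
theorem torsion_mem_MxTMEnv_of_muXmuDiagram {A : AbsTopMonoids S} {G : IsoClass S.Gk} {Q : Type u}
    [AddCommGroup Q] {κ : Q →+ T.cohEnv.lim} (hκ : Rmk152_kummerTorsion T Q κ)
    (Δ : MuXmuDiagram Ev A G Q κ) (y : T.cohEnv.lim) (hy : IsOfFinAddOrder y) : y ∈ Ev.MxTMEnv := by
  have hy' : y ∈ Set.range κ := by rw [hκ.2]; exact hy
  obtain ⟨q, rfl⟩ := hy'
  rw [← Δ.e₁₂_compat q]
  exact ((Δ.e₁₂ q : Ev.MmuTMEnv) : Ev.MxTMEnv).2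

/-- The same converse on the `Π`-side of `(†×θ)(Π)`: every torsion element of
`lim_J H¹(Π_Ÿ(Π)|_J, (l·Δ_Θ)(Π))` is the image of a unit class. [claim: Mochizuki2012, status: disputed] -/
theorem torsion_mem_map_MxTM_of_muXmuDiagram {A : AbsTopMonoids S} {G : IsoClass S.Gk} {Q : Type u}
    [AddCommGroup Q] {κ : Q →+ T.cohEnv.lim} (hκ : Rmk152_kummerTorsion T Q κ)
    (Δ : MuXmuDiagram Ev A G Q κ) (x : T.D.coh.lim) (hx : IsOfFinAddOrder x) :
    x ∈ Ev.MxTM.map Ev.inclHd := by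
  have h := Ev.torsion_mem_MxTMEnv_of_muXmuDiagram hκ Δ (T.transportLim x)
    (T.transportLim.toAddMonoidHom.isOfFinAddOrder hx)
  obtain ⟨m, hm, hmx⟩ := (Ev.mem_MxTMEnv_iff _).mp h
  exact AddSubgroup.mem_map.mpr ⟨m, hm, T.transportLim.injective hmx⟩

end ThetaEvaluation

/-- The second `≅` of `(†μ,×μ)` ("determined by the vertical arrows of `(†×θ)(Π)`", kurims p. 58) is UNIQUELY
determined: two diagrams over the same evaluation data have the same `e₂₃` (PROVED from `e₂₃_compat` and the
injectivity of the vertical arrow; companion to `MuXmuDiagram.e₁₂_unique`).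
[claim: Mochizuki2012, status: disputed] -/
theorem MuXmuDiagram.e₂₃_unique {Ev : ThetaEvaluation T E I} {A : AbsTopMonoids S} {G : IsoClass S.Gk}
    {Q : Type u} [AddCommGroup Q] {κ : Q →+ T.cohEnv.lim} (Δ₁ Δ₂ : MuXmuDiagram Ev A G Q κ) :
    Δ₁.e₂₃ = Δ₂.e₂₃ := by
  ext x
  have h := (Δ₁.e₂₃_compat x).trans (Δ₂.e₂₃_compat x).symm
  exact congrArg Subtype.val (congrArg Subtype.val
    (Subtype.ext (Subtype.ext (Ev.transportLim_inclHd_injective h)) :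
      (Δ₁.e₂₃ x : Ev.MmuTM) = Δ₂.e₂₃ x))

end Literature.IUT.HodgeArakelov
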